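import Literature.MathematicalPhysics.QuantumFieldTheory.Balaban1983to89.B9Ineq347GAAtLetters
import Literature.MathematicalPhysics.QuantumFieldTheory.Balaban1983to89.Node00.OpsYSectDCoords

/-!
# `Balaban1983to89.B9Prop26AtPinsOne` — [4] Prop. 2.6 (2.136) p. 247 (N03's theorem of record) READ ONTO node00-def-Y's PINNED COORDINATE MODELS
# AT A CONFIGURATION READING `1`: block majorants of `G_A(1) = Δ_a⁻¹`, `∇_UG_A(1)`, `G_A(1)∇*_U`, `Δ_UG_A(1)` in dag-n06-d's κ-fold coordinates (torus block map)

T. Bałaban, *Propagators for lattice gauge theories in a background field*, Commun. Math. Phys. **99** (1985) 389–434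
[`Balaban1985BackgroundPropagators`, "B9"]; [4] = T. Bałaban, *Propagators and renormalization transformations for lattice gauge
theories. II*, Commun. Math. Phys. **96** (1984) 223–250 [`Balaban1984PropagatorsII`].

statement-level skeleton of published theorems with citation tags; proofs where landed; nothing here is a claim about the Yang–Mills
mass gap

THE PRINTED LOCI (verbatim).  [B9] Thm 3.3 p. 399: *"the operator G(U) (a = 1) satisfies the inequalities (3.42)–(3.47)"*; p. 407, the sentence
before Cor. 3.5: *"There we have proved these theorems for operators with the external gauge field configuration U = 1."*  [4] Prop. 2.6 p. 247:
*"|(GJ)(x)|, |(∇GJ)(x)|, |(G∇\*J)(x)|, |(ΔGJ)(x)| ≤ O(1)[(L^jη)², L^jη, L^jη, 1]e^{−δ₃d(y,y′)}|J| (2.136) for x ∈ Δ(y), y ∈ Λ_j, supp J ⊂ Δ(y′)"*;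
(2.51) p. 232 (the majorant shape).

THE POINT.  The N06 certificate (dag-n06-d, editions 16–17) pins the Sect.-D letter `G₀ = G_A` of its rows-20–21 record `𝔬12 x` to node00-def-Y's
coordinate model `GcoK … (lettersYOfRecordV4 …).GA` over dag-n06-d's κ-fold carrier `XBK` (`hG0co12`), `∇_U ∕ ∇*_U ∕ Δ_U` to `DcoK ∕ DscoK ∕ LcoK`.  AT `U = 1`
the letter `G_A(1)` acts on product-form inputs `J ⊗ E` as r03's genuine `G = Δ_a⁻¹` (`Node00.OpsYDeltaA.GAY_one_liftY`: `G_A(1)(J ⊗ E) = (Gop J) ⊗ E`),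
`∇_{1,ν} ∕ ∇*_{1,ν} ∕ Δ_1` as `DV ν ∕ DVa ν ∕ LapV` (dag-n06-g `cdB_one_liftY ∕ cdsB_one_liftY ∕ lapB_one_liftY`), and (2.136) for `G` on the genuine k-level
census is dag-n03-a's hypothesis-free `B6Prop26PrintedKLevelFinalV1.prop26Printed_kLevel`.  THIS FILE reads the one onto the other: §1 (2.136) as
[4]-(2.51) block majorants of `Gop`, `∇_νGop`, `Gop∇*_ν`, `ΔGop` w.r.t. the fine-bond block map `blkV1` into the torus blocks, uniformly on the census
(this lineage's g2 engine `B9Ineq347GAAtLetters.hasMajorant_of_census2136`; the four private `have`s of `ineq347_G_kIdx` made public); §2 the coordinate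
functor `coordOpK ∕ coordOpKH` on families that act on product-form inputs as real operators acts SLICE BY SLICE — `(coordOpKH b O f)(x, ν, c, c′) =
(T ν f(·, ν, c, c′))(x)`, no basis constant; §3 hence a block majorant of the real letters IS a block majorant of the model (slice-wise block map, same
kernel); §4 ★ at every configuration `U₁` reading `1` the pinned models `GcoK`, `DcoK∘GcoK`, `GcoK∘DscoK`, `LcoK∘GcoK` have (2.136)'s majorants times the
reading constant `cR39 b`, w.r.t. the slice-wise torus block map `p ↦ blkV1 p.1`, uniformly on the census (★★ `hasMajorant_pins_one_kIdx`).  The sequel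
`B9LettersHAtOneG0` re-blocks to the certificate's index-bond block map and composes with `Q*(1)`.

HONEST SCOPE.  A READING file: the analytic input is N03's Prop. 2.6 (cited by name), the functor and pins are dag-n06-d's, the letters node00-def-Y's;
nothing of [B9] at curved `U` is asserted; nothing new is estimated.  COUNT-NEUTRAL; N06 is NOT discharged; one finite lattice at a time; nothing
continuum, nothing about the mass gap.  Cell `pub-ymgap` (HUMAN RULING D-0062), Track A node N06 [B9], bundle F3 (the `U = 1` obligations, Cor. 3.5 ∕
[4]), seat `pub-ymgap-dag-n06-h` (g19), 2026-08-27.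
-/

noncomputable section

namespace Literature.MathematicalPhysics.QuantumFieldTheory.Balaban1983to89.B9Prop26AtPinsOne

open B6MultiLevelBoxOperator (N0)
open B6MultiLevelTorusOperator (TDomains)
open B6Geom246MultiLevelBox (bset)
open B6Geom246MultiLevelTorus (geomT)
open B6GlobalChartV1 (PV blkV1)
open B6KLevelCensusIndexV1 (KIdx kGeo kGeoG)
open B6GradLegKLevelV1 (DV)
open B6LapLegKLevelV1 (DVa LapV)
open B6Prop26Census2136KLevelV1 (Gop supIn kG)
open B6RandomWalk (HasMajorant BlockSupp)
open B6RandomWalkHom (HasMajorantHom)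
open B6 (pref4)
open B9Ineq347GAAtLetters (hasMajorant_of_census2136 abs_le_supIn)
open B9Cor35ComparisonsGAAtLetters (cdB_one_liftY cdsB_one_liftY lapB_one_liftY)
open B9Thm39ReadingCoords (cR39 cR39_nonneg)
open B9CoReadingCoords B9CoReadingCoordsH
open Node00 Node00.OpsYSectDCoords
open scoped Matrix

variable {d ℓ : ℕ} {hd : 1 ≤ d + 1} {hL : Odd (ℓ + 1) ∧ 1 < ℓ + 1} {b₀ b₁ : ℝ}

/-! ## §1 (2.136) for `Gop = Δ_a⁻¹` as block majorants w.r.t. the fine-bond block map, every k-level index above one threshold -/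

section Census

/-- ★ **[4] PROP. 2.6 (2.136) AS BLOCK MAJORANTS, UNIFORM ON THE k-LEVEL CENSUS**: for the band `0 < b₀ ≤ b₁` there are `M₁, δ₃, C > 0` such that for
every index `i` with `M ≥ M₁` the genuine operator `G = Δ_a⁻¹` (r03's `Gop i`, fine bonds, physical differences `DV ∕ DVa ∕ LapV`) has, w.r.t. the
block map `blkV1` into the torus blocks `𝔅`, the [4]-(2.51) majorants `C·η²L^{2j(y)}·e^{−δ₃d(y,y′)}` (`GJ`), `C·ηL^{j(y)}·e^{−δ₃d}` (`∇_νGJ` and `G∇*_νJ`,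
every `ν`), `C·e^{−δ₃d}` (`ΔGJ`) — N03's theorem of record `B6Prop26PrintedKLevelFinalV1.prop26Printed_kLevel`, first conjunct, unpacked by this
lineage's `B9Ineq347GAAtLetters.hasMajorant_of_census2136` (the four `have`s of `ineq347_G_kIdx`, made public).
[cite: Balaban1984PropagatorsII, Prop. 2.6 (2.136) p.247 + (2.51) p.232; Balaban1985BackgroundPropagators, Thm 3.3 p.399 + Cor. 3.5 p.407] -/
theorem hasMajorant_Gop_kIdx (hb₀ : 0 < b₀) (hb₁ : b₀ ≤ b₁) : ∃ M₁ δ₃ C : ℝ, 0 < M₁ ∧ 0 < δ₃ ∧ 0 < C ∧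
    ∀ i : KIdx d ℓ hd hL b₀ b₁, M₁ ≤ (kGeoG i).M →
      HasMajorant (g := geomT i.D) (blkV1 i.hN i.D) (Gop i)
          (fun y y' => C * |i.cf|⁻¹ ^ 2 * ((ℓ : ℝ) + 1) ^ (2 * y.1.1) * Real.exp (-(δ₃ * (geomT i.D).dist y y'))) ∧
      (∀ ν : Fin (d + 1), HasMajorant (g := geomT i.D) (blkV1 i.hN i.D) (DV ν i.cf ∘ₗ Gop i)
          (fun y y' => C * |i.cf|⁻¹ ^ 1 * ((ℓ : ℝ) + 1) ^ (1 * y.1.1) * Real.exp (-(δ₃ * (geomT i.D).dist y y')))) ∧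
      (∀ ν : Fin (d + 1), HasMajorant (g := geomT i.D) (blkV1 i.hN i.D) (Gop i ∘ₗ DVa ν i.cf)
          (fun y y' => C * |i.cf|⁻¹ ^ 1 * ((ℓ : ℝ) + 1) ^ (1 * y.1.1) * Real.exp (-(δ₃ * (geomT i.D).dist y y')))) ∧
      HasMajorant (g := geomT i.D) (blkV1 i.hN i.D) (LapV i.cf ∘ₗ Gop i)
          (fun y y' => C * |i.cf|⁻¹ ^ 0 * ((ℓ : ℝ) + 1) ^ (0 * y.1.1) * Real.exp (-(δ₃ * (geomT i.D).dist y y'))) := by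
  obtain ⟨M₁, δ₃, C', Cα, Cε, Cαε, hM₁, hδ₃, hC', H⟩ :=
    B6Prop26PrintedKLevelFinalV1.prop26Printed_kLevel (d := d) (ℓ := ℓ) (hd := hd) (hL := hL) hb₀ hb₁
  refine ⟨M₁, δ₃, C', hM₁, hδ₃, hC', fun i hM => ?_⟩
  have h2136 := (H i trivial hM).1
  refine ⟨?_, fun ν => ?_, fun ν => ?_, ?_⟩
  · exact hasMajorant_of_census2136 i 0 2 hC'.le (h2136 0) (fun t => by simp [pref4]) fun J x => abs_le_supIn i (Gop i J) x
  · refine hasMajorant_of_census2136 i 1 1 hC'.le (h2136 1) (fun t => by simp [pref4]) fun J x => ?_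
    exact (abs_le_supIn i ((DV ν i.cf ∘ₗ Gop i) J) x).trans
      (le_ciSup (f := fun ν : Fin (d + 1) => supIn i (blkV1 i.hN i.D x) ((DV ν i.cf ∘ₗ Gop i) J)) (Set.finite_range _).bddAbove ν)
  · refine hasMajorant_of_census2136 i 2 1 hC'.le (h2136 2) (fun t => by simp [pref4]) fun J x => ?_
    exact (abs_le_supIn i ((Gop i ∘ₗ DVa ν i.cf) J) x).trans
      (le_ciSup (f := fun ν : Fin (d + 1) => supIn i (blkV1 i.hN i.D x) ((Gop i ∘ₗ DVa ν i.cf) J)) (Set.finite_range _).bddAbove ν)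
  · exact hasMajorant_of_census2136 i 3 0 hC'.le (h2136 3) (fun t => by simp [pref4]) fun J x => abs_le_supIn i ((LapV i.cf ∘ₗ Gop i) J) x

end Census

/-! ## §2 The coordinate functor on families acting on product-form inputs as real operators: slice by slice, no basis constant -/

section Slices

variable {𝔸 : Type} [NormedRing 𝔸] [NormedAlgebra ℂ 𝔸]
variable {κ : Type} [Fintype κ] [DecidableEq κ]
variable {S S' D : Type} (b : Module.Basis κ ℝ 𝔸)

omit [DecidableEq κ] in
/-- re-assembly is a sum of product-form vectors: `assembleK b ν c′ f = Σ_a (f(·, ν, a, c′)) ⊗ b_a`. [cite: Balaban1985BackgroundPropagators, (3.39) p.397, dictionary] -/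
theorem assembleK_eq_sum_liftY (ν : D) (c' : κ) (f : S' × D × κ × κ → ℝ) :
    assembleK b ν c' f = ∑ a, liftY (fun z => f (z, ν, a, c')) (b a) := by
  funext z
  simp only [assembleK, Finset.sum_apply, liftY_apply, Complex.coe_smul]

omit [DecidableEq κ] in
/-- the `c`-th coordinate of `Σ_a g_a(x) • b_a` is `g_c(x)`. [cite: Balaban1985BackgroundPropagators, (3.39) p.397, dictionary] -/
theorem repr_sum_liftY_apply (g : κ → S → ℝ) (x : S) (c : κ) : b.repr (∑ a, liftY (g a) (b a) x) c = g c x := by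
  simp only [liftY_apply, Complex.coe_smul, map_sum, map_smul, Module.Basis.repr_self, Finsupp.smul_single, smul_eq_mul, mul_one,
    Finsupp.finsetSum_apply]
  rw [Finset.sum_eq_single c]
  · rw [Finsupp.single_eq_same]
  · intro a _ ha; simp [ha]
  · intro h; exact absurd (Finset.mem_univ _) h

omit [DecidableEq κ] in
/-- ★ **A MIXED COORDINATE MODEL WHOSE LETTERS ACT ON PRODUCT-FORM INPUTS AS REAL OPERATORS ACTS SLICE BY SLICE**: if `O ν (f ⊗ E) = (T ν f) ⊗ E` for
all `f, E`, then `(coordOpKH b O f)(x, ν, c, c′) = (T ν (f(·, ν, c, c′)))(x)` — no basis constant appears.  (At `U = 1` every letter of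
node00-def-Y's layer acts so: `GAY_one_liftY`, `QsY_one` with `liftMatY_liftY`, `cdB_one_liftY`, ….)
[cite: Balaban1985BackgroundPropagators, (3.39) p.397 (𝔤-valued fields), (3.42) p.397, Cor. 3.5 p.407; Balaban1984PropagatorsII, (2.51) p.232, dictionary] -/
theorem coordOpKH_apply_of_liftY {O : D → (S' → 𝔸) →ₗ[ℝ] (S → 𝔸)} {T : D → (S' → ℝ) →ₗ[ℝ] (S → ℝ)}
    (hO : ∀ (ν : D) (f : S' → ℝ) (E : 𝔸), O ν (liftY f E) = liftY (T ν f) E) (f : S' × D × κ × κ → ℝ) (p : S × D × κ × κ) :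
    coordOpKH b O f p = T p.2.1 (fun z => f (z, p.2.1, p.2.2.1, p.2.2.2)) p.1 := by
  rw [coordOpKH_apply, assembleK_eq_sum_liftY, map_sum]
  simp only [hO]
  rw [Finset.sum_apply]
  exact repr_sum_liftY_apply b (fun a => T p.2.1 (fun z => f (z, p.2.1, a, p.2.2.2))) p.1 p.2.2.1

omit [DecidableEq κ] in
/-- ★ the bond-sector (square) case of `coordOpKH_apply_of_liftY`. [cite: Balaban1985BackgroundPropagators, (3.42) p.397; Balaban1984PropagatorsII, (2.51) p.232, dictionary] -/
theorem coordOpK_apply_of_liftY {O : D → (S → 𝔸) →ₗ[ℝ] (S → 𝔸)} {T : D → (S → ℝ) →ₗ[ℝ] (S → ℝ)}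
    (hO : ∀ (ν : D) (f : S → ℝ) (E : 𝔸), O ν (liftY f E) = liftY (T ν f) E) (f : S × D × κ × κ → ℝ) (p : S × D × κ × κ) :
    coordOpK b O f p = T p.2.1 (fun z => f (z, p.2.1, p.2.2.1, p.2.2.2)) p.1 := by
  rw [← coordOpKH_eq_coordOpK]
  exact coordOpKH_apply_of_liftY b hO f p

end Slices

/-! ## §3 Block majorants pass to the coordinate models verbatim (the slice-wise block map) -/

section Majorants

variable {𝔸 : Type} [NormedRing 𝔸] [NormedAlgebra ℂ 𝔸]
variable {κ : Type} [Fintype κ] [DecidableEq κ]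
variable {S S' D : Type} (b : Module.Basis κ ℝ 𝔸) {G : B6.Geometry}

omit [Fintype κ] [DecidableEq κ] in
/-- a coordinate vector block-supported for the slice-wise block map has block-supported slices. [cite: Balaban1984PropagatorsII, (2.51) p.232, bookkeeping] -/
theorem blockSupp_slice {blk : S' → G.Site} {μ : S' × D × κ × κ → ℝ} {y' : G.Site} {B : ℝ}
    (hμ : BlockSupp (fun p : S' × D × κ × κ => blk p.1) μ y' B) (ν : D) (c c' : κ) :
    BlockSupp blk (fun z => μ (z, ν, c, c')) y' B :=
  ⟨hμ.nonneg, fun z hz => hμ.bound (z, ν, c, c') hz, fun z hz => hμ.off (z, ν, c, c') hz⟩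

omit [DecidableEq κ] in
/-- ★ **A TWO-SPACE BLOCK MAJORANT OF THE REAL LETTERS IS A BLOCK MAJORANT OF THE MIXED COORDINATE MODEL** (slice-wise block maps, the SAME kernel `K`).
[cite: Balaban1985BackgroundPropagators, (3.42) p.397; Balaban1984PropagatorsII, (2.51) p.232] -/
theorem hasMajorantHom_coordOpKH_of_liftY {O : D → (S' → 𝔸) →ₗ[ℝ] (S → 𝔸)} {T : D → (S' → ℝ) →ₗ[ℝ] (S → ℝ)}
    (hO : ∀ (ν : D) (f : S' → ℝ) (E : 𝔸), O ν (liftY f E) = liftY (T ν f) E) {blk' : S' → G.Site} {blk : S → G.Site}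
    {K : G.Site → G.Site → ℝ} (hK : ∀ ν, HasMajorantHom blk' blk (T ν) K) :
    HasMajorantHom (fun p : S' × D × κ × κ => blk' p.1) (fun p : S × D × κ × κ => blk p.1) (coordOpKH b O) K := by
  intro y' μ B hμ p
  rw [coordOpKH_apply_of_liftY b hO]
  exact hK p.2.1 y' _ B (blockSupp_slice hμ p.2.1 p.2.2.1 p.2.2.2) p.1

omit [DecidableEq κ] in
/-- ★ the square case: a block majorant of the real letters is a block majorant of the bond-sector coordinate model. [cite: Balaban1985BackgroundPropagators, (3.42) p.397; Balaban1984PropagatorsII, (2.51) p.232] -/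
theorem hasMajorant_coordOpK_of_liftY {O : D → (S → 𝔸) →ₗ[ℝ] (S → 𝔸)} {T : D → (S → ℝ) →ₗ[ℝ] (S → ℝ)}
    (hO : ∀ (ν : D) (f : S → ℝ) (E : 𝔸), O ν (liftY f E) = liftY (T ν f) E) {blk : S → G.Site}
    {K : G.Site → G.Site → ℝ} (hK : ∀ ν, HasMajorant blk (T ν) K) :
    HasMajorant (fun p : S × D × κ × κ => blk p.1) (coordOpK b O) K := by
  intro y' μ B hμ p
  rw [coordOpK_apply_of_liftY b hO]
  exact hK p.2.1 y' _ B (blockSupp_slice hμ p.2.1 p.2.2.1 p.2.2.2) p.1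

omit [Fintype κ] [DecidableEq κ] in
/-- a non-negative multiple of an operator with a block majorant. [cite: Balaban1984PropagatorsII, (2.51) p.232, bookkeeping] -/
theorem hasMajorant_smul_of_nonneg {X : Type} {blk : X → G.Site} {T : Module.End ℝ (X → ℝ)} {K : G.Site → G.Site → ℝ}
    (h : HasMajorant blk T K) {r : ℝ} (hr : 0 ≤ r) : HasMajorant blk (r • T) (fun a a' => r * K a a') := by
  intro y' μ B hμ x
  rw [LinearMap.smul_apply, Pi.smul_apply, smul_eq_mul, abs_mul, abs_of_nonneg hr, mul_assoc]
  exact mul_le_mul_of_nonneg_left (h y' μ B hμ x) hr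

end Majorants

/-! ## §4 (2.136) for the PINNED coordinate models `GcoK ∕ DcoK∘GcoK ∕ GcoK∘DscoK ∕ LcoK∘GcoK` at a configuration reading `1`, torus block map -/

section Pins

variable {𝔸 : Type} [NormedRing 𝔸] [NormedAlgebra ℂ 𝔸] [CompleteSpace 𝔸] [FiniteDimensional ℝ 𝔸]
variable {κ : Type} [Fintype κ]
variable (i : KIdx d ℓ hd hL b₀ b₁) (b : Module.Basis κ ℝ 𝔸) (B : B9.Backgrounds) (cfg : B.Cfg → CfgY 𝔸 i) (O : BondOpY 𝔸 i)

/-- ★★ **THE PINNED MODEL OF `G_A` AT `U = 1` HAS `G`'s BLOCK MAJORANT, SCALED BY THE READING CONSTANT**: for a letter `O` whose value at the trivial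
configuration acts on product-form inputs as a real operator `T` (`O(1)(J ⊗ E) = (TJ) ⊗ E` — node00-def-Y's `GAY_one_liftY` with `T = Gop i`, the
record's clause `CovLettersY.GA_one`), a block majorant `K` of `T` w.r.t. the fine-bond block map is the block majorant `cR39 b · K` of
`GcoK i b B cfg O U₁` at every `U₁` with `cfg U₁ = 1`, w.r.t. the slice-wise block map. [cite: Balaban1985BackgroundPropagators, (3.42) p.397, Cor. 3.5 p.407; Balaban1984PropagatorsII, (2.51) p.232, Prop. 2.6 (2.136) p.247] -/
theorem hasMajorant_GcoK_of_liftY {T : Module.End ℝ (FBondY i → ℝ)} {U₁ : B.Cfg} (hU₁ : cfg U₁ = fun _ _ => 1)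
    (hO : ∀ (J : FBondY i → ℝ) (E : 𝔸), O (fun _ _ => 1) (liftY J E) = liftY (T J) E)
    {G : B6.Geometry} {blk : FBondY i → G.Site} {K : G.Site → G.Site → ℝ} (hK : HasMajorant blk T K) :
    HasMajorant (fun p : XBK κ i => blk p.1) (GcoK i b B cfg O U₁) (fun a a' => cR39 b * K a a') := by
  rw [GcoK, hU₁]
  exact hasMajorant_smul_of_nonneg
    (hasMajorant_coordOpK_of_liftY b (O := fun _ : Fin (d + 1) => (O (fun _ _ => 1)).restrictScalars ℝ)
      (T := fun _ => T) (fun _ J E => hO J E) fun _ => hK) (cR39_nonneg b)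

/-- ★★ the same for `∇_U ∘ G_A` at `U = 1`: `DcoK ∘ GcoK` has the majorant `cR39 b · K₁` of the family `ν ↦ ∇_ν ∘ T` (dag-n06-g's `cdB_one_liftY`).
[cite: Balaban1985BackgroundPropagators, (3.42) p.397, Cor. 3.5 p.407; Balaban1984PropagatorsII, (2.51) p.232, Prop. 2.6 (2.136) p.247] -/
theorem hasMajorant_DcoK_GcoK_of_liftY {T : Module.End ℝ (FBondY i → ℝ)} {U₁ : B.Cfg} (hU₁ : cfg U₁ = fun _ _ => 1)
    (hO : ∀ (J : FBondY i → ℝ) (E : 𝔸), O (fun _ _ => 1) (liftY J E) = liftY (T J) E)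
    {G : B6.Geometry} {blk : FBondY i → G.Site} {K : G.Site → G.Site → ℝ} (hK : ∀ ν, HasMajorant blk (DV ν i.cf ∘ₗ T) K) :
    HasMajorant (fun p : XBK κ i => blk p.1) (DcoK i b B cfg U₁ ∘ₗ GcoK i b B cfg O U₁) (fun a a' => cR39 b * K a a') := by
  rw [DcoK_comp_GcoK, hU₁]
  refine hasMajorant_smul_of_nonneg (hasMajorant_coordOpK_of_liftY b (T := fun ν => DV ν i.cf ∘ₗ T) (fun ν J E => ?_) hK) (cR39_nonneg b)
  rw [LinearMap.comp_apply, LinearMap.restrictScalars_apply, hO, cdBₗ_apply, cdB_one_liftY, LinearMap.comp_apply]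

/-- ★★ the same for `G_A ∘ ∇*_U` at `U = 1`: `GcoK ∘ DscoK` has the majorant `cR39 b · K₂` of the family `ν ↦ T ∘ ∇*_ν` (`cdsB_one_liftY`).
[cite: Balaban1985BackgroundPropagators, (3.42) p.397, Cor. 3.5 p.407; Balaban1984PropagatorsII, (2.51) p.232, Prop. 2.6 (2.136) p.247] -/
theorem hasMajorant_GcoK_DscoK_of_liftY {T : Module.End ℝ (FBondY i → ℝ)} {U₁ : B.Cfg} (hU₁ : cfg U₁ = fun _ _ => 1)
    (hO : ∀ (J : FBondY i → ℝ) (E : 𝔸), O (fun _ _ => 1) (liftY J E) = liftY (T J) E)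
    {G : B6.Geometry} {blk : FBondY i → G.Site} {K : G.Site → G.Site → ℝ} (hK : ∀ ν, HasMajorant blk (T ∘ₗ DVa ν i.cf) K) :
    HasMajorant (fun p : XBK κ i => blk p.1) (GcoK i b B cfg O U₁ ∘ₗ DscoK i b B cfg U₁) (fun a a' => cR39 b * K a a') := by
  rw [GcoK_comp_DscoK, hU₁]
  refine hasMajorant_smul_of_nonneg (hasMajorant_coordOpK_of_liftY b (T := fun ν => T ∘ₗ DVa ν i.cf) (fun ν J E => ?_) hK) (cR39_nonneg b)
  rw [LinearMap.comp_apply, LinearMap.restrictScalars_apply, cdsBₗ_apply, cdsB_one_liftY, hO, LinearMap.comp_apply]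

/-- ★★ the same for `Δ_U ∘ G_A` at `U = 1`: `LcoK ∘ GcoK` has the majorant `cR39 b · K₃` of `Δ ∘ T` (`lapB_one_liftY`).
[cite: Balaban1985BackgroundPropagators, (3.42) p.397, Cor. 3.5 p.407; Balaban1984PropagatorsII, (2.51) p.232, Prop. 2.6 (2.136) p.247] -/
theorem hasMajorant_LcoK_GcoK_of_liftY {T : Module.End ℝ (FBondY i → ℝ)} {U₁ : B.Cfg} (hU₁ : cfg U₁ = fun _ _ => 1)
    (hO : ∀ (J : FBondY i → ℝ) (E : 𝔸), O (fun _ _ => 1) (liftY J E) = liftY (T J) E)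
    {G : B6.Geometry} {blk : FBondY i → G.Site} {K : G.Site → G.Site → ℝ} (hK : HasMajorant blk (LapV i.cf ∘ₗ T) K) :
    HasMajorant (fun p : XBK κ i => blk p.1) (LcoK i b B cfg U₁ ∘ₗ GcoK i b B cfg O U₁) (fun a a' => cR39 b * K a a') := by
  rw [LcoK_comp_GcoK, hU₁]
  refine hasMajorant_smul_of_nonneg (hasMajorant_coordOpK_of_liftY b (T := fun _ => LapV i.cf ∘ₗ T) (fun _ J E => ?_) fun _ => hK)
    (cR39_nonneg b)
  rw [LinearMap.comp_apply, LinearMap.restrictScalars_apply, hO, lapBₗ_apply, lapB_one_liftY, LinearMap.comp_apply]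

/-- ★★★ **[4] PROP. 2.6 (2.136) READ ONTO THE PINNED MODELS AT `U = 1`, UNIFORMLY ON THE CENSUS**: for the band `0 < b₀ ≤ b₁` there are
`M₁, δ₃, C > 0` such that for every index `i` with `M ≥ M₁`, every basis `b`, every background class and reading `cfg`, every letter `O` with
the `U = 1` clause `O(1)(J ⊗ E) = (GJ) ⊗ E` (`G = Δ_a⁻¹`, r03's `Gop i`) and every `U₁` with `cfg U₁ = 1`, the four pinned models `GcoK`, `DcoK∘GcoK`,
`GcoK∘DscoK`, `LcoK∘GcoK` have the block majorants `cR39 b·C·[η²L^{2j(y)}, ηL^{j(y)}, ηL^{j(y)}, 1]·e^{−δ₃d_T(y,y′)}` w.r.t. the slice-wise torus block map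
`p ↦ blkV1 p.1`. [cite: Balaban1984PropagatorsII, Prop. 2.6 (2.136) p.247 + (2.51) p.232; Balaban1985BackgroundPropagators, Thm 3.3 p.399, (3.42) p.397, Cor. 3.5 p.407] -/
theorem hasMajorant_pins_one_kIdx (hb₀ : 0 < b₀) (hb₁ : b₀ ≤ b₁) : ∃ M₁ δ₃ C : ℝ, 0 < M₁ ∧ 0 < δ₃ ∧ 0 < C ∧
    ∀ i : KIdx d ℓ hd hL b₀ b₁, M₁ ≤ (kGeoG i).M → ∀ (b : Module.Basis κ ℝ 𝔸) (B : B9.Backgrounds) (cfg : B.Cfg → CfgY 𝔸 i)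
      (O : BondOpY 𝔸 i), (∀ (J : FBondY i → ℝ) (E : 𝔸), O (fun _ _ => 1) (liftY J E) = liftY (Gop i J) E) →
      ∀ U₁ : B.Cfg, cfg U₁ = (fun _ _ => 1) →
        HasMajorant (g := geomT i.D) (fun p : XBK κ i => blkV1 i.hN i.D p.1) (GcoK i b B cfg O U₁)
            (fun y y' => cR39 b * (C * |i.cf|⁻¹ ^ 2 * ((ℓ : ℝ) + 1) ^ (2 * y.1.1) * Real.exp (-(δ₃ * (geomT i.D).dist y y')))) ∧
        HasMajorant (g := geomT i.D) (fun p : XBK κ i => blkV1 i.hN i.D p.1) (DcoK i b B cfg U₁ ∘ₗ GcoK i b B cfg O U₁)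
            (fun y y' => cR39 b * (C * |i.cf|⁻¹ ^ 1 * ((ℓ : ℝ) + 1) ^ (1 * y.1.1) * Real.exp (-(δ₃ * (geomT i.D).dist y y')))) ∧
        HasMajorant (g := geomT i.D) (fun p : XBK κ i => blkV1 i.hN i.D p.1) (GcoK i b B cfg O U₁ ∘ₗ DscoK i b B cfg U₁)
            (fun y y' => cR39 b * (C * |i.cf|⁻¹ ^ 1 * ((ℓ : ℝ) + 1) ^ (1 * y.1.1) * Real.exp (-(δ₃ * (geomT i.D).dist y y')))) ∧
        HasMajorant (g := geomT i.D) (fun p : XBK κ i => blkV1 i.hN i.D p.1) (LcoK i b B cfg U₁ ∘ₗ GcoK i b B cfg O U₁)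
            (fun y y' => cR39 b * (C * |i.cf|⁻¹ ^ 0 * ((ℓ : ℝ) + 1) ^ (0 * y.1.1) * Real.exp (-(δ₃ * (geomT i.D).dist y y')))) := by
  obtain ⟨M₁, δ₃, C, hM₁, hδ₃, hC, H⟩ := hasMajorant_Gop_kIdx (d := d) (ℓ := ℓ) (hd := hd) (hL := hL) hb₀ hb₁
  refine ⟨M₁, δ₃, C, hM₁, hδ₃, hC, fun i hM b B cfg O hO U₁ hU₁ => ?_⟩
  obtain ⟨h0, h1, h2, h3⟩ := H i hM
  exact ⟨hasMajorant_GcoK_of_liftY i b B cfg O hU₁ hO h0, hasMajorant_DcoK_GcoK_of_liftY i b B cfg O hU₁ hO h1,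
    hasMajorant_GcoK_DscoK_of_liftY i b B cfg O hU₁ hO h2, hasMajorant_LcoK_GcoK_of_liftY i b B cfg O hU₁ hO h3⟩

end Pins

end Literature.MathematicalPhysics.QuantumFieldTheory.Balaban1983to89.B9Prop26AtPinsOne

end
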